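import Literature.NumberTheory.EllipticCurves.CongruentNumberCurveJacobiSums
import Mathlib.Data.Nat.Factorial.BigOperators
import HarnessLib

/-!
# Gauss's congruence `C((p-1)/2, (p-1)/4) ≡ 2a (mod p)` for `p = a² + b²`, `a ≡ 1 (mod 4)`

Topic `Literature/NumberTheory/GaussSums` (companion of `JacobiBinomialCongruence.lean`, which
records Jacobi's cubic analogue `C(2(p-1)/3, (p-1)/3) ≡ -r (mod p)` as a named fact and says
"Deliberately NOT here: … Gauss' Theorem 1 for `p ≡ 1 (mod 4)`"). Here Gauss's theorem is
**proved**, from the quartic Jacobi sum of the tree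
(`Literature.NumberTheory.EllipticCurves.GaussianQuartic`, file `CongruentNumberCurveJacobiSums`:
the quartic residue character `χ_π : 𝔽_p → ℤ[i]` of a Gaussian prime `π` of norm `p ≡ 1 (mod 4)`,
the reduction map `φ_π : ℤ[i] → 𝔽_p` with `φ_π(χ_π(t)) = t^{(p-1)/4}`, and Ireland–Rosen's
Prop. 9.9.4 `-χ_π(-1) J(χ_π, χ_π) = π` for `π` primary, `neg_mul_jacobiSum_eq`).

Source statements.

* Cosgrave–Dilcher, *Mod p³ analogues of theorems of Gauss and Jacobi on binomial coefficients*,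
  Acta Arith. 142 (2010), p. 103: "(1.1) `p ≡ 1 (mod 4)`, `p = a² + b²`, `a ≡ 1 (mod 4)`. …
  **Theorem 1 (Gauss).** Let the prime `p` and the integer `a` be as in (1.1). Then
  (1.2) `C((p-1)/2, (p-1)/4) ≡ 2a (mod p)`." (Gauss 1828; Berndt–Evans–Williams 1998, p. 268.)
* Matthews, *Gauss sums and elliptic functions II. The quartic sum*, Invent. Math. 54 (1979),
  §2, (2.11), p. 28: with `p = 4M + 1 = 2N + 1` and `ϖ` primary, "the same method gives the
  congruence `ϖ' ≡ (-1)^M C(N, M) mod (ϖ)` (see [H1] p. 428)" (`[H1]` = Hasse, *Vorlesungen über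
  Zahlentheorie*) — the form in which the congruence enters Matthews' determination of the sign
  of the quartic Gauss sum (loc. cit. (5.4), (7.11)); and Prop. 2.1, p. 26: for `ϖ = a + bi`
  primary, "`a ≡ (-1)^M mod 4` and `b/2 ≡ M mod 2`".

Proof (the classical one; Matthews: "the same method"): in `𝔽_p`, with `M = (p-1)/4`,
`φ_π(J(χ_π³, χ_π³)) = ∑_t t^{3M} (1-t)^{3M} = ∑_k (-1)^k C(3M,k) ∑_t t^{3M+k}`, and the power sum
`∑_t t^e` (`0 < e < 2(p-1)`) is `-1` for `e = p - 1 = 4M` and `0` otherwise, so only `k = M`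
survives: `φ_π(J(χ̄, χ̄)) = (-1)^{M+1} C(3M, M)`. Since `J(χ̄, χ̄) = \overline{J(χ, χ)}`
`= -χ(-1) ϖ'` (Prop. 9.9.4) and `φ_π(χ(-1)) = (-1)^M`, this gives `φ_π(ϖ') = C(3M, M)`
`= C(p-1-M, M) ≡ (-1)^M C(2M, M)`, which is (2.11); and `φ_π(ϖ') = 2a` because `φ_π(ϖ) = 0`.
Finally `(-1)^M` is read off from the primary normalisation (Prop. 2.1: `M ≡ b/2 (mod 2)`).

## Main statements (namespace `Literature.NumberTheory.GaussSums`)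

* `GaussBinomial.sum_pow_eq` — power sums in `𝔽_p` below `2(p-1)`.
* `GaussBinomial.choose_sub_eq` — `C(p-1-j, k) ≡ (-1)^k C(j+k, k) (mod p)` for `j + k < p`.
* `GaussBinomial.red_jacobiSum_chi_cube` — `φ_π(J(χ³, χ³)) = -(-1)^M C(3M, M)`.
* `GaussBinomial.red_star_eq` — **Matthews (2.11)**: `φ_π(ϖ') = (-1)^M C(N, M)` for `ϖ` primary.
* `GaussBinomial.im_div_two_mod_two_eq`, `GaussBinomial.re_mod_four_eq`,
  `GaussBinomial.neg_one_pow_div_four_eq` — **Matthews Prop. 2.1**: `b/2 ≡ M (mod 2)`,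
  `a ≡ (-1)^M (mod 4)` for `ϖ = a + bi` primary.
* `GaussBinomial.two_mul_re_eq` — `2a ≡ (-1)^M C(N, M) (mod p)` for `ϖ = a + bi` primary.
* `gauss1828_centralBinom` — **Gauss's theorem** in the form (1.1)–(1.2) of Cosgrave–Dilcher.

No definitions and no named facts are introduced (D-0026): everything is a theorem.
-/

open Finset

namespace Literature.NumberTheory.GaussSums

namespace GaussBinomial

open Literature.NumberTheory.EllipticCurves.GaussianQuartic
open Literature.NumberTheory.QuadraticFields.GaussianPrimary

variable {p : ℕ} [hp : Fact p.Prime]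

/-! ### Power sums and a binomial congruence in `𝔽_p` -/

/-- Power sums over `𝔽_p` below twice the period: for `0 < e < 2(p-1)`,
`∑_{t ∈ 𝔽_p} t^e = -1` if `e = p - 1` and `= 0` otherwise. [folklore] -/
theorem sum_pow_eq {e : ℕ} (he : 0 < e) (he2 : e < 2 * (p - 1)) :
    ∑ t : ZMod p, t ^ e = if e = p - 1 then -1 else 0 := by
  have hp2 := hp.out.two_le
  split_ifs with h
  · have key : ∀ t : ZMod p, t ^ e = if t = 0 then 0 else 1 := by
      intro t
      split_ifs with ht
      · rw [ht, zero_pow he.ne']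
      · rw [h, ZMod.pow_card_sub_one_eq_one ht]
    simp_rw [key]
    rw [Finset.sum_ite, Finset.sum_const_zero, zero_add, Finset.sum_const, nsmul_eq_mul, mul_one]
    have hcard : (Finset.univ.filter fun t : ZMod p ↦ ¬t = 0).card = p - 1 := by
      rw [Finset.filter_ne' Finset.univ (0 : ZMod p), Finset.card_erase_of_mem (Finset.mem_univ _),
        Finset.card_univ, ZMod.card]
    rw [hcard, Nat.cast_sub (by omega), ZMod.natCast_self, Nat.cast_one, zero_sub]
  · by_cases hlt : e < p - 1
    · have := FiniteField.sum_pow_lt_card_sub_one (K := ZMod p) e (by rwa [ZMod.card])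
      exact this
    · have h1 : 0 < e - (p - 1) := by omega
      have h2 : e - (p - 1) < p - 1 := by omega
      have key : ∀ t : ZMod p, t ^ e = t ^ (e - (p - 1)) := by
        intro t
        rcases eq_or_ne t 0 with rfl | ht
        · rw [zero_pow he.ne', zero_pow h1.ne']
        · conv_lhs => rw [show e = (e - (p - 1)) + (p - 1) by omega, pow_add,
            ZMod.pow_card_sub_one_eq_one ht, mul_one]
      simp_rw [key]
      have := FiniteField.sum_pow_lt_card_sub_one (K := ZMod p) (e - (p - 1)) (by rwa [ZMod.card])
      exact this

/-- `C(p-1-j, k) ≡ (-1)^k C(j+k, k) (mod p)` for `j + k < p` (both sides times `k!` are the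
products `∏_{i<k} (p-1-j-i) ≡ ∏_{i<k} (-(j+1+i))`). [folklore] -/
theorem choose_sub_eq (j k : ℕ) (hjk : j + k < p) :
    ((Nat.choose (p - 1 - j) k : ℕ) : ZMod p) = (-1) ^ k * ((Nat.choose (j + k) k : ℕ) : ZMod p) := by
  have hk : ((k.factorial : ℕ) : ZMod p) ≠ 0 := by
    rw [Ne, ZMod.natCast_eq_zero_iff]
    intro h
    have := hp.out.dvd_factorial.mp h
    omega
  apply mul_left_cancel₀ hk
  have h1 : ((k.factorial : ℕ) : ZMod p) * ((Nat.choose (p - 1 - j) k : ℕ) : ZMod p) =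
      ∏ i ∈ range k, ((p - 1 - j - i : ℕ) : ZMod p) := by
    rw [← Nat.cast_mul, ← Nat.descFactorial_eq_factorial_mul_choose,
      Nat.descFactorial_eq_prod_range, Nat.cast_prod]
  have h2 : ((k.factorial : ℕ) : ZMod p) * ((Nat.choose (j + k) k : ℕ) : ZMod p) =
      ∏ i ∈ range k, ((j + 1 + i : ℕ) : ZMod p) := by
    rw [← Nat.cast_mul, ← Nat.ascFactorial_eq_factorial_mul_choose,
      Nat.ascFactorial_eq_prod_range, Nat.cast_prod]
  rw [h1, mul_left_comm, h2,
    show ((-1 : ZMod p)) ^ k = ∏ _i ∈ range k, (-1 : ZMod p) by rw [prod_const, card_range],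
    ← prod_mul_distrib]
  refine prod_congr rfl fun i hi ↦ ?_
  rw [mem_range] at hi
  have hsum : (p - 1 - j - i) + (j + 1 + i) = p := by omega
  have h0 : ((p - 1 - j - i : ℕ) : ZMod p) + ((j + 1 + i : ℕ) : ZMod p) = 0 := by
    rw [← Nat.cast_add, hsum, ZMod.natCast_self]
  linear_combination h0

/-! ### `φ_π(J(χ̄, χ̄))` and Matthews' congruence (2.11) -/

variable {π : GaussianInt}

/-- `J(χ_π³, χ_π³) = \overline{J(χ_π, χ_π)}` (`χ̄ = χ³`). [folklore] -/
theorem jacobiSum_chi_cube_eq_star (hp1 : p % 4 = 1) (hπp : π.norm = p) :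
    jacobiSum (chi hp1 hπp ^ 3) (chi hp1 hπp ^ 3) =
      star (jacobiSum (chi hp1 hπp) (chi hp1 hπp)) := by
  rw [jacobiSum, jacobiSum, star_sum]
  refine sum_congr rfl fun t _ ↦ ?_
  rw [star_mul', star_chi hp1 hπp, star_chi hp1 hπp, MulChar.pow_apply' _ three_ne_zero,
    MulChar.pow_apply' _ three_ne_zero]

/-- **`φ_π(J(χ_π³, χ_π³)) = -(-1)^M C(3M, M)`**, `M = (p-1)/4`: the power-sum evaluation of the
conjugate quartic Jacobi sum modulo `π` (Matthews 1979, §2, "the same method [as for (2.10)]";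
Ireland–Rosen, proof of Prop. 9.9.4 for the method). [cite: Matthews1979Quartic, §2 (2.11) p. 28] -/
theorem red_jacobiSum_chi_cube (hp1 : p % 4 = 1) (hπp : π.norm = p) :
    red hπp (jacobiSum (chi hp1 hπp ^ 3) (chi hp1 hπp ^ 3)) =
      -(-1) ^ (p / 4) * ((Nat.choose (3 * (p / 4)) (p / 4) : ℕ) : ZMod p) := by
  have h4 := four_mul_div_four hp1
  have h5 := five_le hp1
  rw [jacobiSum, map_sum]
  simp_rw [map_mul, MulChar.pow_apply' _ three_ne_zero, map_pow, red_chi' hp1 hπp]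
  set m := p / 4 with hm
  have hexp : ∀ t : ZMod p, (t ^ m) ^ 3 * ((1 - t) ^ m) ^ 3 =
      ∑ k ∈ range (3 * m + 1),
        ((-1) ^ k * ((Nat.choose (3 * m) k : ℕ) : ZMod p)) * t ^ (3 * m + k) := by
    intro t
    rw [← pow_mul, ← pow_mul, mul_comm m 3, show (1 - t) = -t + 1 by ring, add_pow,
      Finset.mul_sum]
    refine sum_congr rfl fun k _ ↦ ?_
    rw [one_pow, mul_one, neg_pow, pow_add]
    ring
  simp_rw [hexp]
  rw [Finset.sum_comm]
  have inner : ∀ k ∈ range (3 * m + 1),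
      ∑ t : ZMod p, ((-1) ^ k * ((Nat.choose (3 * m) k : ℕ) : ZMod p)) * t ^ (3 * m + k) =
        ((-1) ^ k * ((Nat.choose (3 * m) k : ℕ) : ZMod p)) * ∑ t : ZMod p, t ^ (3 * m + k) :=
    fun k _ ↦ (Finset.mul_sum _ _ _).symm
  rw [Finset.sum_congr rfl inner, Finset.sum_eq_single_of_mem m (by rw [mem_range]; omega)]
  · rw [sum_pow_eq (by omega) (by omega), if_pos (by omega)]
    ring
  · intro k hk hkm
    rw [mem_range] at hk
    rw [sum_pow_eq (by omega) (by omega), if_neg (by omega), mul_zero]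

/-- **Matthews' congruence (2.11): `φ_π(ϖ') = (-1)^M C(N, M)`** in `𝔽_p` for `ϖ` primary,
`p = 4M + 1 = 2N + 1` ("`ϖ' ≡ (-1)^M C(N, M) mod (ϖ)`", Matthews 1979, §2, p. 28, citing Hasse,
*Vorlesungen*, p. 428). [cite: Matthews1979Quartic, §2 (2.11) p. 28] -/
theorem red_star_eq (hp1 : p % 4 = 1) (hπp : π.norm = p) (hπ : IsPrimary π) :
    red hπp (star π) = (-1) ^ (p / 4) * ((Nat.choose (p / 2) (p / 4) : ℕ) : ZMod p) := by
  have h4 := four_mul_div_four hp1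
  have h5 := five_le hp1
  have hJ := neg_mul_jacobiSum_eq hp1 hπp hπ
  have hstar : star π =
      -(chi hp1 hπp (-1) ^ 3 * jacobiSum (chi hp1 hπp ^ 3) (chi hp1 hπp ^ 3)) := by
    calc star π = star (-(chi hp1 hπp (-1) * jacobiSum (chi hp1 hπp) (chi hp1 hπp))) := by
          rw [hJ]
      _ = _ := by
          rw [star_neg, star_mul', star_chi hp1 hπp, jacobiSum_chi_cube_eq_star hp1 hπp]
  rw [hstar, map_neg, map_mul, map_pow, red_chi' hp1 hπp, red_jacobiSum_chi_cube hp1 hπp]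
  have hC : ((Nat.choose (3 * (p / 4)) (p / 4) : ℕ) : ZMod p) =
      (-1) ^ (p / 4) * ((Nat.choose (p / 2) (p / 4) : ℕ) : ZMod p) := by
    have := choose_sub_eq (p := p) (p / 4) (p / 4) (by omega)
    rwa [show p - 1 - p / 4 = 3 * (p / 4) by omega, show p / 4 + p / 4 = p / 2 by omega] at this
  rw [hC]
  have hs : ((-1 : ZMod p) ^ (p / 4)) ^ 2 = 1 := by
    rw [← pow_mul, mul_comm, pow_mul, neg_one_sq, one_pow]
  set s := (-1 : ZMod p) ^ (p / 4)
  set C := ((Nat.choose (p / 2) (p / 4) : ℕ) : ZMod p)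
  linear_combination (s * C * (s ^ 2 + 1)) * hs

/-! ### Matthews' Prop. 2.1: the primary normalisation and the parity of `M` -/

omit hp in
/-- **`b/2 ≡ M (mod 2)`** for `ϖ = a + bi` primary of norm `p = 4M + 1` (Matthews 1979,
Prop. 2.1: `b/2 ≡ b²/4 ≡ (p - a²)/4 ≡ M mod 2` since `a² ≡ 1 mod 8`).
[cite: Matthews1979Quartic, §2 Prop. 2.1 p. 26] -/
theorem im_div_two_mod_two_eq (hπp : π.norm = p) (hπ : IsPrimary π) :
    (π.im / 2) % 2 = ((p / 4 : ℕ) : ℤ) % 2 := by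
  have hn : π.re * π.re + π.im * π.im = p := by rw [← hπp, Zsqrtd.norm_def]; ring
  unfold IsPrimary at hπ
  set s := π.re / 2 with hs
  set t := π.im / 2 with ht
  have ha : π.re = 2 * s + 1 := by omega
  have hb : π.im = 2 * t := by omega
  rw [ha, hb] at hn
  obtain ⟨X, hX⟩ : ∃ X : ℤ, X = s * s + s + t * t := ⟨_, rfl⟩
  have hpX : (p : ℤ) = 4 * X + 1 := by rw [hX]; linear_combination -hn
  have hp4 : ((p / 4 : ℕ) : ℤ) = X := by omega
  obtain ⟨c, hc⟩ := Int.even_mul_succ_self s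
  obtain ⟨d, hd⟩ := Int.even_mul_succ_self (t - 1)
  have hX' : X = (c + c) + (d + d) + t := by rw [hX]; linear_combination hc + hd
  rw [hp4]
  omega

omit hp in
/-- **`a ≡ (-1)^M (mod 4)`** for `ϖ = a + bi` primary of norm `p = 4M + 1` (Matthews 1979,
Prop. 2.1). [cite: Matthews1979Quartic, §2 Prop. 2.1 p. 26] -/
theorem re_mod_four_eq (hπp : π.norm = p) (hπ : IsPrimary π) :
    π.re % 4 = if Even (p / 4) then 1 else 3 := by
  have h := im_div_two_mod_two_eq hπp hπ
  unfold IsPrimary at hπ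
  rcases hπ with ⟨ha, hb⟩ | ⟨ha, hb⟩
  · rw [if_pos (by rw [Nat.even_iff]; omega)]
    exact ha
  · rw [if_neg (by rw [Nat.not_even_iff_odd, Nat.odd_iff]; omega)]
    exact ha

omit hp in
/-- `(-1)^M = ±1` according as `a ≡ ±1 (mod 4)`, for `ϖ = a + bi` primary of norm `p = 4M + 1`
(Matthews 1979, Prop. 2.1, restated). [cite: Matthews1979Quartic, §2 Prop. 2.1 p. 26] -/
theorem neg_one_pow_div_four_eq {R : Type*} [Monoid R] [HasDistribNeg R]
    (hπp : π.norm = p) (hπ : IsPrimary π) :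
    (-1 : R) ^ (p / 4) = if π.re % 4 = 1 then 1 else -1 := by
  have h := im_div_two_mod_two_eq hπp hπ
  unfold IsPrimary at hπ
  rcases hπ with ⟨ha, hb⟩ | ⟨ha, hb⟩
  · rw [if_pos ha]
    have : Even (p / 4) := by rw [Nat.even_iff]; omega
    exact this.neg_one_pow
  · rw [if_neg (by omega)]
    have : Odd (p / 4) := by rw [Nat.odd_iff]; omega
    exact this.neg_one_pow

/-! ### Gauss's theorem -/

/-- **`2a ≡ (-1)^M C(N, M) (mod p)`** for `ϖ = a + bi` primary of norm `p = 4M + 1 = 2N + 1`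
((2.11) with `φ_π(ϖ') = 2a`, as `φ_π(ϖ) = 0`). [cite: Matthews1979Quartic, §2 (2.11) p. 28] -/
theorem two_mul_re_eq (hp1 : p % 4 = 1) (hπp : π.norm = p) (hπ : IsPrimary π) :
    2 * ((π.re : ℤ) : ZMod p) = (-1) ^ (p / 4) * ((Nat.choose (p / 2) (p / 4) : ℕ) : ZMod p) := by
  rw [← red_star_eq hp1 hπp hπ, red_apply]
  have h0 := red_self hπp
  rw [red_apply] at h0
  simp only [Zsqrtd.re_star, Zsqrtd.im_star, Int.cast_neg]
  linear_combination h0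

end GaussBinomial

open Literature.NumberTheory.QuadraticFields.GaussianPrimary in
/-- **Gauss's theorem (1828)** (Cosgrave–Dilcher 2010, Theorem 1 with (1.1)–(1.2)): let `p` be a
prime with `p ≡ 1 (mod 4)` and write `p = a² + b²` with `a ≡ 1 (mod 4)`. Then
`C((p-1)/2, (p-1)/4) ≡ 2a (mod p)`. Stated in `ZMod p`. Proof: `two_mul_re_eq` for the primary
associate `±a + bi` and Matthews' Prop. 2.1 for the sign `(-1)^{(p-1)/4} ≡ ±1`.
[cite: CosgraveDilcher2010, Thm 1 (1.2) p. 103] -/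
theorem gauss1828_centralBinom (p : ℕ) (a b : ℤ) (hp : p.Prime) (hp1 : p % 4 = 1)
    (hab : a ^ 2 + b ^ 2 = p) (ha : a % 4 = 1) :
    ((Nat.choose ((p - 1) / 2) ((p - 1) / 4) : ℕ) : ZMod p) = 2 * (a : ZMod p) := by
  haveI := Fact.mk hp
  rw [show (p - 1) / 2 = p / 2 by omega, show (p - 1) / 4 = p / 4 by omega]
  have hb : b % 4 = 0 ∨ b % 4 = 2 := by
    rcases Int.even_or_odd b with ⟨t, ht⟩ | ⟨t, ht⟩
    · omega
    · exfalso
      obtain ⟨u, hu⟩ : ∃ u, a = 4 * u + 1 := ⟨a / 4, by omega⟩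
      obtain ⟨Y, hY⟩ : ∃ Y : ℤ, Y = 8 * u * u + 4 * u + 2 * t * t + 2 * t + 1 := ⟨_, rfl⟩
      have h2 : (p : ℤ) = 2 * Y := by rw [hY, ← hab, hu, ht]; ring
      omega
  rcases hb with hb | hb
  · have hn : (⟨a, b⟩ : GaussianInt).norm = p := by rw [Zsqrtd.norm_def, ← hab]; ring
    have hprim : IsPrimary (⟨a, b⟩ : GaussianInt) := Or.inl ⟨ha, hb⟩
    have h := GaussBinomial.two_mul_re_eq hp1 hn hprim
    have hs : (-1 : ZMod p) ^ (p / 4) = 1 := by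
      rw [GaussBinomial.neg_one_pow_div_four_eq hn hprim, if_pos ha]
    rw [hs, one_mul] at h
    exact h.symm
  · have hn : (⟨-a, b⟩ : GaussianInt).norm = p := by rw [Zsqrtd.norm_def, ← hab]; ring
    have hprim : IsPrimary (⟨-a, b⟩ : GaussianInt) := Or.inr ⟨by show (-a) % 4 = 3; omega, hb⟩
    have h := GaussBinomial.two_mul_re_eq hp1 hn hprim
    have hs : (-1 : ZMod p) ^ (p / 4) = -1 := by
      rw [GaussBinomial.neg_one_pow_div_four_eq hn hprim, if_neg (by show ¬ (-a) % 4 = 1; omega)]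
    rw [hs] at h
    push_cast at h
    linear_combination h

end Literature.NumberTheory.GaussSums

/-! ### Sanity checks (small primes, by `decide`)

`p = 5 = 1² + 2²`: `C(2,1) = 2 ≡ 2·1`; `p = 13 = (-3)² + 2²`, `a = -3 ≡ 1 (mod 4)`:
`C(6,3) = 20 ≡ 7 ≡ -6 = 2a (mod 13)`; `p = 17 = 1² + 4²`: `C(8,4) = 70 ≡ 2 (mod 17)`;
`p = 29 = 5² + 2²`: `C(14,7) = 3432 ≡ 10 (mod 29)`. -/

example : ((Nat.choose 6 3 : ℕ) : ZMod 13) = 2 * ((-3 : ℤ) : ZMod 13) := by decide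
example : ((Nat.choose 8 4 : ℕ) : ZMod 17) = 2 * ((1 : ℤ) : ZMod 17) := by decide
example : ((Nat.choose 14 7 : ℕ) : ZMod 29) = 2 * ((5 : ℤ) : ZMod 29) := by decide
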